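import Summits.FinalStateConjecture.FinalStateConjecture.Theorems.PhaseMixingCaptureCaptureSufficesTameNoC0LimitBlock
import HarnessLib

/-!
# NoC0KerrChart limit argument V: the tail (identification, no early exit, one period)

Crux `CaptureSufficesTame` (stmt-FinalStateConjecture-17270), line `only-the-third-law-is-generic`, NoC0KerrChart
programme, lead c10. Registered sub-goal of this file: `stub_noC0_limitTail` (`NoC0.limit_tail`).

Given the generators `μ_n` through the anchors `x_n → Γ tx`, their exit times `E_n` (ultralimit `EU ≥ tx`), the pointwise
ultralimit `y` on `[0, EU)` and crossing-point anchors on `(0, tx]`: (7) `y = Γ` on `[tx, min EU (3/2)eS)` by `lr_block` and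
a least-upper-bound induction; (8) no exit before `(3/2)eS` (the generators shadow the orbit, `η₀`-deep in `Ω`); (9) after one
period `y (eS) = Γ (eS) = p₀ + eS ∂_{t*}` (periodicity of the orbit) is reached from `p₀` by the static timelike curve,
which (TL) transplants to a `B_n`-timelike curve from `p₀ ∈ C_n` to `μ_n (eS) ∉ O_n` — contradiction.

References: B. O'Neill, *Semi-Riemannian geometry* (1983), Ch. 10, Prop. 10.46 (key `ONeillSemiRiemannian1983`);
J. Sbierski, Anal. PDE 8 (2015), §7A (key `Sbierski2015`).
-/

set_option linter.dupNamespace false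
set_option maxSynthPendingDepth 3

noncomputable section

open Set Filter Function Bundle MeasureTheory Metric
open scoped Manifold ContDiff Topology ENNReal

namespace Summit.FinalStateConjecture.FinalStateConjecture.Theorems.PhaseMixingCaptureCaptureSufficesTame

open Literature.Geometry.Lorentzian Literature.Geometry.Riemannian

namespace NoC0

variable {M a : ℝ}

set_option maxHeartbeats 800000 in
/-- **Tail of the limit argument** (stages 7–9): given the generators `μ_n` through the anchors `x_n → Γ tx`, their exit
times `E_n` with ultralimit `EU ≥ tx`, the pointwise ultralimit `y` on `[0, EU)` and crossing-point anchors on `(0, tx]`,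
(7) `y = Γ` on `[tx, min EU (3/2)eS)` by the continuation block `lr_block` and a least-upper-bound induction, (8) the
generators cannot approach `∂Ω` before `t* = (3/2)eS` (they shadow the orbit, which is `η₀`-deep in `Ω`), and (9) after one
period `y (eS) = Γ (eS) = p₀ + eS ∂_{t*}` is the endpoint of the static timelike curve at `p₀`, which (TL) transplants to a
`B_n`-timelike curve from `p₀ ∈ C_n` to `μ_n (eS) ∉ O_n` — contradiction. [cite: ONeillSemiRiemannian1983, Ch. 10, Prop. 10.46] -/
theorem limit_tail (M a : ℝ) [Kerr.Facts] [Kerr.SliceFacts] (hM : 0 < M) (ha0 : 0 ≤ a) (haM : a ≤ M)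
    (r₀ e S : ℝ) (h3 : 3 * M ≤ r₀) (hcubic : r₀ * (r₀ - 3 * M) ^ 2 = 4 * a ^ 2 * M)
    (he : e = 1 - a * √(M / r₀ ^ 3)) (hS : S = 2 * Real.pi / √(M / r₀ ^ 3)) (he0 : 0 < e) (he1 : e ≤ 1)
    (hq0' : 0 < √(M / r₀ ^ 3))
    (Ω : Set E4) (hΩext : closure Ω ⊆ (Kerr.exterior M a : Set E4)) (hΩc : IsCompact (closure Ω))
    (η₀ : ℝ) (hη₀ : 0 < η₀)
    (htube : cthickening η₀ (Kerr.orbitCurve a r₀ √(M / r₀ ^ 3) '' Icc (-S) (2 * S)) ⊆ Ω)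
    (hH : ∀ y ∈ cthickening η₀ (Kerr.orbitCurve a r₀ √(M / r₀ ^ 3) '' Icc (-S) (2 * S)), Kerr.scalarH M a y ≤ 2 / 5)
    (hvert : cthickening η₀ ((fun w : ℝ ↦ Kerr.orbitCurve a r₀ √(M / r₀ ^ 3) 0 + w • E4.basisVector 0) '' Icc 0 (2 * S)) ⊆ Ω)
    (hDL3 : ∀ (M a : ℝ) (x v : E4) (B : E4 →L[ℝ] E4 →L[ℝ] ℝ) (ε κ : ℝ), 0 ≤ M → Kerr.scalarH M a x ≤ 2 / 5 →
      ‖B - Kerr.bilin M a x‖ ≤ ε → ε ≤ 1 / 80 → B v v ≤ 0 → v 0 = 1 → 0 ≤ κ →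
      Kerr.bilin M a x (v + κ • E4.basisVector 0) (v + κ • E4.basisVector 0) ≤ 4 * ε - κ / 10)
    (hTL : ∀ (M a : ℝ) (K₁ : Set E4) (δ₀ : ℝ), 0 ≤ M → IsCompact K₁ → 0 < δ₀ →
      cthickening δ₀ K₁ ⊆ (Kerr.exterior M a : Set E4) →
      ∀ (c c' : ℝ → E4) (L : ℝ), 0 < L → (∀ r ∈ Icc 0 L, HasDerivAt c (c' r) r) → ContinuousOn c' (Icc 0 L) →
      (∀ r ∈ Icc 0 L, c r ∈ K₁ ∧ Kerr.bilin M a (c r) (c' r) (c' r) < 0 ∧ 0 < c' r 0) →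
      ∃ δ > 0, δ ≤ δ₀ ∧ ∀ (z₁ z₂ : E4), ‖z₁‖ < δ → ‖z₂‖ < δ → ∀ B : E4 → E4 →L[ℝ] E4 →L[ℝ] ℝ,
        (∀ y ∈ cthickening δ₀ K₁, ‖B y - Kerr.bilin M a y‖ < δ) →
        ∀ r ∈ Icc 0 L, c r + (1 - r / L) • z₁ + (r / L) • z₂ ∈ thickening δ₀ K₁ ∧
          HasDerivAt (fun r ↦ c r + (1 - r / L) • z₁ + (r / L) • z₂) (c' r + (1 / L) • (z₂ - z₁)) r ∧
          B (c r + (1 - r / L) • z₁ + (r / L) • z₂) (c' r + (1 / L) • (z₂ - z₁)) (c' r + (1 / L) • (z₂ - z₁)) < 0 ∧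
          0 < (c' r + (1 / L) • (z₂ - z₁)) 0)
    (𝒰 : Ultrafilter ℕ) (ε : ℕ → ℝ) (hε0 : ∀ n, 0 ≤ ε n) (hε4 : ∀ n, ε n ≤ 1 / 80)
    (hεU : Tendsto ε (𝒰 : Filter ℕ) (𝓝 0))
    (B : ℕ → E4 → E4 →L[ℝ] E4 →L[ℝ] ℝ) (hB : ∀ n, ∀ y ∈ Ω, ‖B n y - Kerr.bilin M a y‖ ≤ ε n)
    (C O : ℕ → Set E4) (hCΩ : ∀ n, C n ⊆ Ω)
    (hD : ∀ n, ∀ y ∈ C n, ∀ z ∈ Ω, (∃ (c : ℝ → E4) (s₁ s₂ : ℝ), s₁ < s₂ ∧ c s₁ = y ∧ c s₂ = z ∧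
      ∀ t ∈ Icc s₁ s₂, c t ∈ Ω ∧ ∃ v : E4, HasDerivAt c v t ∧ B n (c t) v v < 0 ∧ 0 < v 0) → z ∈ O n)
    (hp : ∀ n, Kerr.orbitCurve a r₀ √(M / r₀ ^ 3) 0 ∈ C n ∧ Kerr.orbitCurve a r₀ √(M / r₀ ^ 3) 0 ∉ O n)
    (ht : ∀ n, ∀ y ∈ C n, Kerr.orbitCurve a r₀ √(M / r₀ ^ 3) 0 0 ≤ y 0)
    (tx : ℝ) (htx : 0 < tx) (h4S : 4 * tx ≤ e * S)
    (xs : ℝ → ℕ → E4)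
    (hxs : ∀ s ∈ Ioc 0 tx, ∀ᶠ n in (𝒰 : Filter ℕ), xs s n ∈ C n ∧ xs s n ∉ O n ∧
      ∃ u ∈ Icc (-s) s, xs s n = Kerr.orbitCurve a r₀ √(M / r₀ ^ 3) (s / e) + u • E4.basisVector 0)
    (hxslim : ∀ s ∈ Ioc 0 tx, Tendsto (xs s) (𝒰 : Filter ℕ) (𝓝 (Kerr.orbitCurve a r₀ √(M / r₀ ^ 3) (s / e))))
    (μ : ℕ → ℝ → E4) (E : ℕ → ℝ) (U₈ : Set ℕ) (hU₈ev : ∀ᶠ n in (𝒰 : Filter ℕ), n ∈ U₈)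
    (hE : ∀ n ∈ U₈, xs tx n 0 < E n) (hμx : ∀ n ∈ U₈, μ n (xs tx n 0) = xs tx n)
    (hμgen : ∀ n ∈ U₈, ∀ t ∈ Ico 0 (E n), μ n t ∈ C n ∧ μ n t ∉ O n ∧ μ n t 0 = t ∧
      ∃ v : E4, HasDerivAt (μ n) v t ∧ B n (μ n t) v v ≤ 0 ∧ v 0 = 1)
    (hexit : ∀ n ∈ U₈, ∀ η > 0, ∀ t₀ < E n, ∃ t, t₀ ≤ t ∧ 0 ≤ t ∧ t < E n ∧ infDist (μ n t) Ωᶜ < η)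
    (EU : ℝ) (hEU : Tendsto (fun n ↦ min (E n) (2 * (e * S))) (𝒰 : Filter ℕ) (𝓝 EU)) (hEUtx : tx ≤ EU)
    (y : ℝ → E4) (hy : ∀ t, 0 ≤ t ∧ t < EU → Tendsto (fun n ↦ μ n t) (𝒰 : Filter ℕ) (𝓝 (y t)))
    (hytx : tx < EU → y tx = Kerr.orbitCurve a r₀ √(M / r₀ ^ 3) (tx / e)) : False := by
  have hΩext' : Ω ⊆ (Kerr.exterior M a : Set E4) := subset_closure.trans hΩext
  have hr₀ : 0 < r₀ := by linarith
  have hS0 : 0 < S := by rw [hS]; positivity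
  have htime : ∀ s, Kerr.orbitCurve a r₀ √(M / r₀ ^ 3) s 0 = e * s := fun s ↦ by
    rw [Kerr.orbitCurve_apply_zero, he]
  have he0x : ∀ t, Kerr.orbitCurve a r₀ √(M / r₀ ^ 3) (t / e) 0 = t := fun t ↦ by rw [htime]; field_simp
  have hp00 : Kerr.orbitCurve a r₀ √(M / r₀ ^ 3) 0 0 = 0 := by rw [htime, mul_zero]
  have horbkin' := orbit_norm_sub_le' M a r₀ e hM ha0 h3 hcubic he he0
  have hΩnear : ∀ t z, 0 ≤ t → t ≤ 2 * (e * S) → ‖z - Kerr.orbitCurve a r₀ √(M / r₀ ^ 3) (t / e)‖ ≤ η₀ → z ∈ Ω :=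
    fun t z ht0 htS hz ↦ htube (mem_orbitTube he0 hS0.le t z ht0 htS hz)
  have hne0 : ‖E4.basisVector 0‖ = 1 := by simp [E4.basisVector]
  have hb0 : (E4.basisVector 0 : E4) 0 = 1 := by simp [E4.basisVector]
  have hcoord : Continuous fun z : E4 ↦ z 0 := (EuclideanSpace.proj (0 : Fin 4)).continuous
  have htxI : tx ∈ Ioc 0 tx := ⟨htx, le_rfl⟩
  -- kinematics of the generators (K3), both orders
  have hμK3 : ∀ n ∈ U₈, ∀ t₁ t₂, 0 ≤ t₁ → t₁ ≤ t₂ → t₂ < E n → ‖μ n t₂ - μ n t₁‖ ≤ 2 * (t₂ - t₁) := by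
    intro n hn t₁ t₂ h1 h12 h2
    have h := (kerr_time_strictMonoOn_and_norm_sub_le M a (fun s ↦ B n (μ n s)) (μ n) t₁ t₂ hM.le h12
      (fun s' hs' ↦ ?_)).2
    · rw [(hμgen n hn t₂ ⟨by linarith, h2⟩).2.2.1, (hμgen n hn t₁ ⟨h1, by linarith⟩).2.2.1] at h
      exact h
    · obtain ⟨hCs, -, -, v, hv, hBv, hv0⟩ := hμgen n hn s' ⟨by linarith [hs'.1], by linarith [hs'.2]⟩
      exact ⟨(hB n _ (hCΩ n hCs)).trans (by linarith [hε4 n]), v, hv, hBv, by rw [hv0]; exact one_pos⟩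
  have hμK3' : ∀ n ∈ U₈, ∀ t₁ t₂, 0 ≤ t₁ → t₁ < E n → 0 ≤ t₂ → t₂ < E n → ‖μ n t₂ - μ n t₁‖ ≤ 2 * |t₂ - t₁| := by
    intro n hn t₁ t₂ h1 h1E h2 h2E
    rcases le_total t₁ t₂ with h | h
    · rw [abs_of_nonneg (by linarith)]; exact hμK3 n hn t₁ t₂ h1 h h2E
    · rw [abs_of_nonpos (by linarith), norm_sub_rev]
      have := hμK3 n hn t₂ t₁ h2 h h1E
      linarith
  have hxs0 : Tendsto (fun n ↦ xs tx n 0) (𝒰 : Filter ℕ) (𝓝 tx) := by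
    have := (hcoord.tendsto _).comp (hxslim tx htxI)
    simpa [Function.comp_def, he0x] using this
  have hEev : ∀ t, t < EU → ∀ᶠ n in (𝒰 : Filter ℕ), t < E n := fun t htl ↦
    (hEU.eventually (lt_mem_nhds htl)).mono fun n hn ↦ lt_of_lt_of_le hn (min_le_left _ _)
  have hμev : ∀ t, 0 ≤ t → t < EU → ∀ᶠ n in (𝒰 : Filter ℕ), μ n t ∈ C n ∧ μ n t ∉ O n ∧ μ n t 0 = t := fun t h0 hE' ↦ by
    filter_upwards [hU₈ev, hEev t hE'] with n hn hnE
    exact ⟨(hμgen n hn t ⟨h0, hnE⟩).1, (hμgen n hn t ⟨h0, hnE⟩).2.1, (hμgen n hn t ⟨h0, hnE⟩).2.2.1⟩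
  have hyK3 : ∀ t₁ t₂, 0 ≤ t₁ → t₁ ≤ t₂ → t₂ < EU → ‖y t₂ - y t₁‖ ≤ 2 * (t₂ - t₁) := by
    intro t₁ t₂ h1 h12 h2
    have hl := ((hy t₂ ⟨by linarith, h2⟩).sub (hy t₁ ⟨h1, by linarith⟩)).norm
    refine le_of_tendsto hl ?_
    filter_upwards [hU₈ev, hEev t₂ h2] with n hn hnE
    exact hμK3 n hn t₁ t₂ h1 h12 hnE
  /- ═════════ 7. The identification `y = Γ` on `[tx, min EU Tmax)` ═════════ -/
  have hind : ∀ t, tx ≤ t → t < min EU (3 / 2 * (e * S)) → y t = Kerr.orbitCurve a r₀ √(M / r₀ ^ 3) (t / e) := by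
    by_cases hlt : tx < min EU (3 / 2 * (e * S))
    swap
    · intro t h1 h2; linarith
    have htxE : tx < EU := hlt.trans_le (min_le_left _ _)
    set G : Set ℝ := {T | tx ≤ T ∧ T ≤ min EU (3 / 2 * (e * S)) ∧
      ∀ t, tx ≤ t → t < T → y t = Kerr.orbitCurve a r₀ √(M / r₀ ^ 3) (t / e)} with hG
    have htxG : tx ∈ G := ⟨le_rfl, hlt.le, fun t h1 h2 ↦ absurd h2 (not_lt.2 h1)⟩
    have hGbdd : BddAbove G := ⟨min EU (3 / 2 * (e * S)), fun T hT ↦ hT.2.1⟩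
    have hGne : G.Nonempty := ⟨tx, htxG⟩
    obtain ⟨T, hTdef⟩ : ∃ T : ℝ, T = sSup G := ⟨_, rfl⟩
    have htxT : tx ≤ T := by rw [hTdef]; exact le_csSup hGbdd htxG
    have hTle : T ≤ min EU (3 / 2 * (e * S)) := by rw [hTdef]; exact csSup_le hGne fun T hT ↦ hT.2.1
    have hbelow : ∀ t, tx ≤ t → t < T → y t = Kerr.orbitCurve a r₀ √(M / r₀ ^ 3) (t / e) := by
      intro t h1 h2
      rw [hTdef] at h2
      obtain ⟨T', hTG, htT⟩ := exists_lt_of_lt_csSup hGne h2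
      exact hTG.2.2 t h1 htT
    have hGle : ∀ T' ∈ G, T' ≤ T := fun T' hT' ↦ by rw [hTdef]; exact le_csSup hGbdd hT'
    suffices hsup : T = min EU (3 / 2 * (e * S)) by
      intro t h1 h2; exact hbelow t h1 (hsup ▸ h2)
    by_contra hne
    have hTlt : T < min EU (3 / 2 * (e * S)) := lt_of_le_of_ne hTle hne
    have hTE : T < EU := hTlt.trans_le (min_le_left _ _)
    have hTS' : T < 3 / 2 * (e * S) := hTlt.trans_le (min_le_right _ _)
    -- `y T = Γ T`
    have hyT : y T = Kerr.orbitCurve a r₀ √(M / r₀ ^ 3) (T / e) := by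
      rcases htxT.eq_or_lt with h | h
      · rw [← h]; exact hytx htxE
      · apply eq_of_norm_sub_le_zero
        apply le_of_forall_pos_lt_add
        intro θ hθ
        obtain ⟨δ, hδdef⟩ : ∃ δ : ℝ, δ = min (θ / 8) ((T - tx) / 2) := ⟨_, rfl⟩
        have hδ : 0 < δ := by rw [hδdef]; exact lt_min (by positivity) (by linarith)
        have hδ1 : δ ≤ θ / 8 := by rw [hδdef]; exact min_le_left _ _
        have hδ2 : δ ≤ (T - tx) / 2 := by rw [hδdef]; exact min_le_right _ _
        have htx1 : tx ≤ T - δ := by linarith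
        have hT1 : T - δ < T := by linarith
        have hT0 : 0 ≤ T - δ := by linarith
        have hy1 := hbelow (T - δ) htx1 hT1
        have hk1 := hyK3 (T - δ) T hT0 hT1.le hTE
        have hk2 := horbkin' (T - δ) T hT1.le
        rw [hy1] at hk1
        have hsub : T - (T - δ) = δ := by ring
        rw [hsub] at hk1 hk2
        calc ‖y T - Kerr.orbitCurve a r₀ √(M / r₀ ^ 3) (T / e)‖
            ≤ ‖y T - Kerr.orbitCurve a r₀ √(M / r₀ ^ 3) ((T - δ) / e)‖ +
              ‖Kerr.orbitCurve a r₀ √(M / r₀ ^ 3) ((T - δ) / e) - Kerr.orbitCurve a r₀ √(M / r₀ ^ 3) (T / e)‖ :=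
              norm_sub_le_norm_sub_add_norm_sub _ _ _
          _ ≤ 2 * δ + 2 * δ := by
              rw [norm_sub_rev] at hk2; exact add_le_add hk1 hk2
          _ < 0 + θ := by linarith
    -- anchors on `[T - tx, T]`
    have hanch : ∀ s ∈ Icc (T - tx) T, ∃ b : ℕ → E4, (∀ᶠ n in (𝒰 : Filter ℕ), b n ∈ C n) ∧
        Tendsto b (𝒰 : Filter ℕ) (𝓝 (Kerr.orbitCurve a r₀ √(M / r₀ ^ 3) (s / e))) := by
      intro s hsI
      rcases le_or_gt s 0 with hs0 | hs0
      · have hs00 : s = 0 := le_antisymm hs0 (by linarith [hsI.1])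
        subst hs00
        refine ⟨fun _ ↦ Kerr.orbitCurve a r₀ √(M / r₀ ^ 3) 0, Eventually.of_forall fun n ↦ (hp n).1, ?_⟩
        rw [zero_div]; exact tendsto_const_nhds
      rcases le_or_gt s tx with hst | hst
      · exact ⟨xs s, (hxs s ⟨hs0, hst⟩).mono fun n h ↦ h.1, hxslim s ⟨hs0, hst⟩⟩
      · refine ⟨fun n ↦ μ n s, (hμev s hs0.le (hsI.2.trans_lt hTE)).mono fun n h ↦ h.1, ?_⟩
        rcases hsI.2.eq_or_lt with h | h
        · rw [h, ← hyT]; exact hy _ ⟨by linarith, hTE⟩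
        · rw [← hbelow s hst.le h]; exact hy s ⟨hs0.le, h.trans hTE⟩
    -- the continuation block at `T`
    obtain ⟨h₀, hh₀def⟩ : ∃ h₀ : ℝ, h₀ = (min EU (3 / 2 * (e * S)) - T) / 2 := ⟨_, rfl⟩
    have hh₀ : 0 < h₀ := by rw [hh₀def]; linarith
    have hh₀E : T + h₀ < EU := by
      rw [hh₀def]; linarith [min_le_left EU (3 / 2 * (e * S))]
    have hh₀S : T + h₀ ≤ 3 / 2 * (e * S) := by
      rw [hh₀def]; linarith [min_le_right EU (3 / 2 * (e * S))]
    have hh₀m : T + h₀ < min EU (3 / 2 * (e * S)) := by rw [hh₀def]; linarith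
    have hT0 : 0 ≤ T := by linarith
    have hμ' : ∀ᶠ n in (𝒰 : Filter ℕ), ∀ s ∈ Icc T (T + h₀), μ n s ∈ C n ∧ μ n s ∉ O n ∧ μ n s 0 = s ∧
        ∃ v : E4, HasDerivAt (μ n) v s ∧ B n (μ n s) v v ≤ 0 ∧ v 0 = 1 := by
      filter_upwards [hU₈ev, hEev _ hh₀E] with n hn hnE
      intro s hs
      exact hμgen n hn s ⟨hT0.trans hs.1, hs.2.trans_lt hnE⟩
    have hy' : ∀ t ∈ Icc T (T + h₀), Tendsto (fun n ↦ μ n t) (𝒰 : Filter ℕ) (𝓝 (y t)) :=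
      fun t htI ↦ hy t ⟨hT0.trans htI.1, htI.2.trans_lt hh₀E⟩
    obtain ⟨h, hh, hhh₀, hblk⟩ := lr_block M a hM ha0 haM r₀ (√(M / r₀ ^ 3)) e S h3 hcubic rfl he hS he0 hq0'
      Ω hΩext η₀ hη₀ htube hH hDL3 hTL (l := (𝒰 : Filter ℕ)) ε hε0 hε4 hεU B hB C O hCΩ hD
      T h₀ tx hT0 hh₀ hh₀S htx μ hμ' y hy' hyT hanch
    have hmemG : T + h ∈ G := by
      refine ⟨by linarith, by linarith, fun t h1 h2 ↦ ?_⟩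
      rcases lt_or_ge t T with h' | h'
      · exact hbelow t h1 h'
      · exact hblk t ⟨h', h2.le⟩
    have := hGle _ hmemG
    linarith
  /- ═════════ 8. The generators do not exit before `Tmax` ═════════ -/
  have hEUbig : 3 / 2 * (e * S) ≤ EU := by
    by_contra hlt'
    push Not at hlt'
    -- a point outside `Ω`, and the distance from orbit points to `Ωᶜ`
    obtain ⟨R, hR⟩ := hΩc.isBounded.subset_closedBall 0
    have hΩcne : (Ωᶜ).Nonempty := by
      refine ⟨(|R| + 1) • E4.basisVector 0, fun hmemΩ ↦ ?_⟩
      have h1 := hR (subset_closure hmemΩ)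
      rw [Metric.mem_closedBall, dist_zero_right, norm_smul, hne0, mul_one, Real.norm_eq_abs,
        abs_of_pos (by positivity)] at h1
      linarith [le_abs_self R]
    have hfar : ∀ t, 0 ≤ t → t ≤ 2 * (e * S) → η₀ ≤ infDist (Kerr.orbitCurve a r₀ √(M / r₀ ^ 3) (t / e)) Ωᶜ := by
      intro t ht0 htS
      rw [Metric.le_infDist hΩcne]
      intro z hz
      by_contra hzd
      push Not at hzd
      exact hz (hΩnear t z ht0 htS (by rw [← dist_eq_norm, dist_comm]; exact hzd.le))
    obtain ⟨θ, hθdef⟩ : ∃ θ : ℝ, θ = min (η₀ / 40) (tx / 4) := ⟨_, rfl⟩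
    have hθ : 0 < θ := by rw [hθdef]; exact lt_min (by positivity) (by positivity)
    have hθ1 : θ ≤ η₀ / 40 := by rw [hθdef]; exact min_le_left _ _
    have hθ2 : θ ≤ tx / 4 := by rw [hθdef]; exact min_le_right _ _
    -- eventually `|E n - EU| < θ`
    have hEclose : ∀ᶠ n in (𝒰 : Filter ℕ), EU - θ < E n ∧ E n < EU + θ := by
      have h1 : ∀ᶠ n in (𝒰 : Filter ℕ), min (E n) (2 * (e * S)) ∈ Ioo (EU - θ) (EU + θ) :=
        hEU.eventually (Ioo_mem_nhds (by linarith) (by linarith))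
      filter_upwards [h1] with n hn
      have h2 : E n < EU + θ := by
        by_contra h'
        push Not at h'
        have : EU + θ ≤ min (E n) (2 * (e * S)) := le_min h' (by linarith)
        linarith [hn.2]
      exact ⟨lt_of_lt_of_le hn.1 (min_le_left _ _), h2⟩
    rcases le_or_gt tx (EU - 2 * θ) with hcase | hcase
    · -- reference time `sref := EU - 2θ ≥ tx`, where `y = Γ`
      have hsE : EU - 2 * θ < min EU (3 / 2 * (e * S)) := lt_min (by linarith) (by linarith)
      have hys := hind (EU - 2 * θ) hcase hsE
      have hs0 : 0 ≤ EU - 2 * θ := by linarith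
      have hlim1 : ∀ᶠ n in (𝒰 : Filter ℕ), ‖μ n (EU - 2 * θ) - Kerr.orbitCurve a r₀ √(M / r₀ ^ 3) ((EU - 2 * θ) / e)‖ < θ := by
        have h1 := hy (EU - 2 * θ) ⟨hs0, by linarith⟩
        rw [hys] at h1
        exact (tendsto_iff_norm_sub_tendsto_zero.1 h1).eventually (gt_mem_nhds hθ)
      obtain ⟨n, hn, hnE, hn1⟩ := (hU₈ev.and (hEclose.and hlim1)).exists
      obtain ⟨t', ht'1, ht'0, ht'E, ht'd⟩ := hexit n hn (η₀ / 2) (half_pos hη₀) (E n - θ) (by linarith)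
      have hK := hμK3 n hn (EU - 2 * θ) t' hs0 (by linarith [hnE.1]) ht'E
      have h1 := Metric.infDist_le_infDist_add_dist (s := Ωᶜ) (x := Kerr.orbitCurve a r₀ √(M / r₀ ^ 3) ((EU - 2 * θ) / e))
        (y := μ n t')
      have h2 : dist (Kerr.orbitCurve a r₀ √(M / r₀ ^ 3) ((EU - 2 * θ) / e)) (μ n t') ≤ θ + 2 * (t' - (EU - 2 * θ)) := by
        rw [dist_comm, dist_eq_norm]
        calc ‖μ n t' - Kerr.orbitCurve a r₀ √(M / r₀ ^ 3) ((EU - 2 * θ) / e)‖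
            ≤ ‖μ n t' - μ n (EU - 2 * θ)‖ + ‖μ n (EU - 2 * θ) - Kerr.orbitCurve a r₀ √(M / r₀ ^ 3) ((EU - 2 * θ) / e)‖ :=
              norm_sub_le_norm_sub_add_norm_sub _ _ _
          _ ≤ 2 * (t' - (EU - 2 * θ)) + θ := add_le_add hK hn1.le
          _ = θ + 2 * (t' - (EU - 2 * θ)) := by ring
      have h3' := hfar (EU - 2 * θ) hs0 (by linarith)
      have : t' - (EU - 2 * θ) < 3 * θ := by linarith [hnE.2]
      linarith
    · -- reference: the anchor points `x_n` (here `EU < tx + 2θ`)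
      have hlim1 : ∀ᶠ n in (𝒰 : Filter ℕ), ‖xs tx n - Kerr.orbitCurve a r₀ √(M / r₀ ^ 3) (tx / e)‖ < θ :=
        (tendsto_iff_norm_sub_tendsto_zero.1 (hxslim tx htxI)).eventually (gt_mem_nhds hθ)
      have hlim2 : ∀ᶠ n in (𝒰 : Filter ℕ), xs tx n 0 ∈ Ioo (tx - θ) (tx + θ) :=
        hxs0.eventually (Ioo_mem_nhds (by linarith) (by linarith))
      obtain ⟨n, hn, hnE, hn1, hn2, hn3⟩ := (hU₈ev.and (hEclose.and (hlim1.and (hlim2.and (hxs tx htxI))))).exists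
      obtain ⟨hC, -, u, huI, hxu⟩ := hn3
      have hx0' : 0 ≤ xs tx n 0 := by have := ht n _ hC; rwa [hp00] at this
      obtain ⟨t', ht'1, ht'0, ht'E, ht'd⟩ := hexit n hn (η₀ / 2) (half_pos hη₀) (E n - θ) (by linarith)
      have hK := hμK3' n hn (xs tx n 0) t' hx0' (hE n hn) ht'0 ht'E
      rw [hμx n hn] at hK
      have habs : |t' - xs tx n 0| ≤ 5 * θ := by
        rw [abs_le]; constructor <;> linarith [hnE.1, hnE.2, hn2.1, hn2.2]
      have h1 := Metric.infDist_le_infDist_add_dist (s := Ωᶜ) (x := Kerr.orbitCurve a r₀ √(M / r₀ ^ 3) (tx / e))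
        (y := μ n t')
      have h2 : dist (Kerr.orbitCurve a r₀ √(M / r₀ ^ 3) (tx / e)) (μ n t') ≤ θ + 10 * θ := by
        rw [dist_comm, dist_eq_norm]
        calc ‖μ n t' - Kerr.orbitCurve a r₀ √(M / r₀ ^ 3) (tx / e)‖
            ≤ ‖μ n t' - xs tx n‖ + ‖xs tx n - Kerr.orbitCurve a r₀ √(M / r₀ ^ 3) (tx / e)‖ :=
              norm_sub_le_norm_sub_add_norm_sub _ _ _
          _ ≤ 2 * |t' - xs tx n 0| + θ := add_le_add hK hn1.le
          _ ≤ θ + 10 * θ := by linarith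
      have h3' := hfar tx htx.le (by linarith)
      linarith
  /- ═════════ 9. One full period: the static curve at `p₀` ═════════ -/
  have heS : e * S < min EU (3 / 2 * (e * S)) := lt_min (by linarith) (by nlinarith [mul_pos he0 hS0])
  have hyeS := hind (e * S) (by linarith) heS
  -- `Γ (eS) = p₀ + (eS) ∂_{t*}`
  have hperiod : Kerr.orbitCurve a r₀ √(M / r₀ ^ 3) (e * S / e) =
      Kerr.orbitCurve a r₀ √(M / r₀ ^ 3) 0 + (e * S) • E4.basisVector 0 := by
    have h1 : e * S / e = 0 + 2 * Real.pi / √(M / r₀ ^ 3) := by rw [mul_div_cancel_left₀ _ he0.ne', hS, zero_add]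
    rw [h1, kerr_orbitCurve_add_period a r₀ (√(M / r₀ ^ 3)) 0 hq0'.ne', ← he, ← hS]
  -- the static curve
  have heS0 : 0 < e * S := mul_pos he0 hS0
  have hp0rad : ∀ w : ℝ, Kerr.radius a (Kerr.orbitCurve a r₀ √(M / r₀ ^ 3) 0 + w • E4.basisVector 0) = r₀ := fun w ↦ by
    rw [Kerr.radius_add_time_smul_basisVector, Kerr.radius_orbitCurve hr₀]
  have hβprop : ∀ r ∈ Icc (0:ℝ) 1,
      HasDerivAt (fun r : ℝ ↦ Kerr.orbitCurve a r₀ √(M / r₀ ^ 3) 0 + (r * (e * S)) • E4.basisVector 0)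
        ((e * S) • E4.basisVector 0) r ∧
      Kerr.bilin M a (Kerr.orbitCurve a r₀ √(M / r₀ ^ 3) 0 + (r * (e * S)) • E4.basisVector 0)
        ((e * S) • E4.basisVector 0) ((e * S) • E4.basisVector 0) < 0 ∧
      0 < ((e * S) • E4.basisVector 0 : E4) 0 := by
    intro r _
    refine ⟨?_, ?_, ?_⟩
    · have := (((hasDerivAt_id' r).mul_const (e * S)).smul_const (E4.basisVector 0)).const_add
        (Kerr.orbitCurve a r₀ √(M / r₀ ^ 3) 0)
      simpa using this
    · have hW1 := kerr_bilin_basisVector_zero_le M a (Kerr.orbitCurve a r₀ √(M / r₀ ^ 3) 0 + (r * (e * S)) • E4.basisVector 0)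
        hM.le (by rw [hp0rad]; exact h3)
      simp only [map_smul, smul_apply, smul_eq_mul]
      have : 0 < (e * S) * (e * S) := by positivity
      nlinarith
    · rw [show ((e * S) • E4.basisVector 0 : E4) 0 = (e * S) * (E4.basisVector 0 : E4) 0 from rfl, hb0, mul_one]
      exact heS0
  have hthick : cthickening η₀ ((fun r : ℝ ↦ Kerr.orbitCurve a r₀ √(M / r₀ ^ 3) 0 + (r * (e * S)) • E4.basisVector 0) '' Icc 0 1) ⊆ Ω := by
    refine (Metric.cthickening_subset_of_subset _ ?_).trans hvert
    rintro _ ⟨r, hr, rfl⟩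
    refine ⟨r * (e * S), ⟨by have := hr.1; positivity, ?_⟩, rfl⟩
    have h1 : r * (e * S) ≤ 1 * (e * S) := by gcongr; exact hr.2
    have h2 : e * S ≤ 1 * S := by gcongr
    linarith
  have hwO : ∀ᶠ n in (𝒰 : Filter ℕ), μ n (e * S) ∉ O n :=
    (hμev (e * S) heS0.le (by linarith)).mono fun n h ↦ h.2.1
  exact transplant_contra (a := a) hM.le hΩext' hTL hεU hB hD
    (fun r : ℝ ↦ Kerr.orbitCurve a r₀ √(M / r₀ ^ 3) 0 + (r * (e * S)) • E4.basisVector 0)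
    (fun _ ↦ (e * S) • E4.basisVector 0) continuousOn_const hβprop hη₀ hthick
    (fun _ ↦ Kerr.orbitCurve a r₀ √(M / r₀ ^ 3) 0) (fun n ↦ μ n (e * S))
    (by simp) (by
      have h1 := hy (e * S) ⟨heS0.le, by linarith⟩
      rw [hyeS, hperiod] at h1
      simpa using h1)
    (Eventually.of_forall fun n ↦ (hp n).1) hwO

end NoC0

/-- **Registered sub-goal `stub_noC0_limitTail`** (NoC0KerrChart programme, crux `CaptureSufficesTame`, line
`only-the-third-law-is-generic`): the tail of the limit argument (`NoC0.limit_tail`), verbatim. [cite: ONeillSemiRiemannian1983, Ch. 10, Prop. 10.46] -/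
theorem stub_noC0_limitTail :
    ∀ (M a : ℝ), ∀ [Kerr.Facts], ∀ [Kerr.SliceFacts], (0 < M) → (0 ≤ a) → (a ≤ M) → ∀ (r₀ e S : ℝ), (3 * M ≤ r₀) → (r₀ * (r₀ - 3 * M) ^ 2 = 4 * a ^ 2 * M) → (e = 1 - a * √(M / r₀ ^ 3)) → (S
      = 2 * Real.pi / √(M / r₀ ^ 3)) → (0 < e) → (e ≤ 1) → (0 < √(M / r₀ ^ 3)) → ∀ (Ω : Set E4), (closure Ω ⊆ (Kerr.exterior M a : Set E4)) → (IsCompact (closure Ω)) → ∀ (η₀ : ℝ), (0 < η₀) →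
      (cthickening η₀ (Kerr.orbitCurve a r₀ √(M / r₀ ^ 3) '' Icc (-S) (2 * S)) ⊆ Ω) → (∀ y ∈ cthickening η₀ (Kerr.orbitCurve a r₀ √(M / r₀ ^ 3) '' Icc (-S) (2 * S)), Kerr.scalarH M a y ≤ 2 /
      5) → (cthickening η₀ ((fun w : ℝ ↦ Kerr.orbitCurve a r₀ √(M / r₀ ^ 3) 0 + w • E4.basisVector 0) '' Icc 0 (2 * S)) ⊆ Ω) → (∀ (M a : ℝ) (x v : E4) (B : E4 →L[ℝ] E4 →L[ℝ] ℝ) (ε κ : ℝ), 0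
      ≤ M → Kerr.scalarH M a x ≤ 2 / 5 → ‖B - Kerr.bilin M a x‖ ≤ ε → ε ≤ 1 / 80 → B v v ≤ 0 → v 0 = 1 → 0 ≤ κ → Kerr.bilin M a x (v + κ • E4.basisVector 0) (v + κ • E4.basisVector 0) ≤ 4 *
      ε - κ / 10) → (∀ (M a : ℝ) (K₁ : Set E4) (δ₀ : ℝ), 0 ≤ M → IsCompact K₁ → 0 < δ₀ → cthickening δ₀ K₁ ⊆ (Kerr.exterior M a : Set E4) → ∀ (c c' : ℝ → E4) (L : ℝ), 0 < L → (∀ r ∈ Icc 0 L,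
      HasDerivAt c (c' r) r) → ContinuousOn c' (Icc 0 L) → (∀ r ∈ Icc 0 L, c r ∈ K₁ ∧ Kerr.bilin M a (c r) (c' r) (c' r) < 0 ∧ 0 < c' r 0) → ∃ δ > 0, δ ≤ δ₀ ∧ ∀ (z₁ z₂ : E4), ‖z₁‖ < δ → ‖z₂‖
      < δ → ∀ B : E4 → E4 →L[ℝ] E4 →L[ℝ] ℝ, (∀ y ∈ cthickening δ₀ K₁, ‖B y - Kerr.bilin M a y‖ < δ) → ∀ r ∈ Icc 0 L, c r + (1 - r / L) • z₁ + (r / L) • z₂ ∈ thickening δ₀ K₁ ∧ HasDerivAt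
      (fun r ↦ c r + (1 - r / L) • z₁ + (r / L) • z₂) (c' r + (1 / L) • (z₂ - z₁)) r ∧ B (c r + (1 - r / L) • z₁ + (r / L) • z₂) (c' r + (1 / L) • (z₂ - z₁)) (c' r + (1 / L) • (z₂ - z₁)) < 0
      ∧ 0 < (c' r + (1 / L) • (z₂ - z₁)) 0) → ∀ (𝒰 : Ultrafilter ℕ), ∀ (ε : ℕ → ℝ), (∀ n, 0 ≤ ε n) → (∀ n, ε n ≤ 1 / 80) → (Tendsto ε (𝒰 : Filter ℕ) (𝓝 0)) → ∀ (B : ℕ → E4 → E4 →L[ℝ] E4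
      →L[ℝ] ℝ), (∀ n, ∀ y ∈ Ω, ‖B n y - Kerr.bilin M a y‖ ≤ ε n) → ∀ (C O : ℕ → Set E4), (∀ n, C n ⊆ Ω) → (∀ n, ∀ y ∈ C n, ∀ z ∈ Ω, (∃ (c : ℝ → E4) (s₁ s₂ : ℝ), s₁ < s₂ ∧ c s₁ = y ∧ c s₂ = z
      ∧ ∀ t ∈ Icc s₁ s₂, c t ∈ Ω ∧ ∃ v : E4, HasDerivAt c v t ∧ B n (c t) v v < 0 ∧ 0 < v 0) → z ∈ O n) → (∀ n, Kerr.orbitCurve a r₀ √(M / r₀ ^ 3) 0 ∈ C n ∧ Kerr.orbitCurve a r₀ √(M / r₀ ^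
      3) 0 ∉ O n) → (∀ n, ∀ y ∈ C n, Kerr.orbitCurve a r₀ √(M / r₀ ^ 3) 0 0 ≤ y 0) → ∀ (tx : ℝ), (0 < tx) → (4 * tx ≤ e * S) → ∀ (xs : ℝ → ℕ → E4), (∀ s ∈ Ioc 0 tx, ∀ᶠ n in (𝒰 : Filter ℕ),
      xs s n ∈ C n ∧ xs s n ∉ O n ∧ ∃ u ∈ Icc (-s) s, xs s n = Kerr.orbitCurve a r₀ √(M / r₀ ^ 3) (s / e) + u • E4.basisVector 0) → (∀ s ∈ Ioc 0 tx, Tendsto (xs s) (𝒰 : Filter ℕ) (𝓝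
      (Kerr.orbitCurve a r₀ √(M / r₀ ^ 3) (s / e)))) → ∀ (μ : ℕ → ℝ → E4), ∀ (E : ℕ → ℝ), ∀ (U₈ : Set ℕ), (∀ᶠ n in (𝒰 : Filter ℕ), n ∈ U₈) → (∀ n ∈ U₈, xs tx n 0 < E n) → (∀ n ∈ U₈, μ n (xs
      tx n 0) = xs tx n) → (∀ n ∈ U₈, ∀ t ∈ Ico 0 (E n), μ n t ∈ C n ∧ μ n t ∉ O n ∧ μ n t 0 = t ∧ ∃ v : E4, HasDerivAt (μ n) v t ∧ B n (μ n t) v v ≤ 0 ∧ v 0 = 1) → (∀ n ∈ U₈, ∀ η > 0, ∀ t₀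
      < E n, ∃ t, t₀ ≤ t ∧ 0 ≤ t ∧ t < E n ∧ infDist (μ n t) Ωᶜ < η) → ∀ (EU : ℝ), (Tendsto (fun n ↦ min (E n) (2 * (e * S))) (𝒰 : Filter ℕ) (𝓝 EU)) → (tx ≤ EU) → ∀ (y : ℝ → E4), (∀ t, 0 ≤ t
      ∧ t < EU → Tendsto (fun n ↦ μ n t) (𝒰 : Filter ℕ) (𝓝 (y t))) → (tx < EU → y tx = Kerr.orbitCurve a r₀ √(M / r₀ ^ 3) (tx / e)) → False :=
  NoC0.limit_tail

end Summit.FinalStateConjecture.FinalStateConjecture.Theorems.PhaseMixingCaptureCaptureSufficesTame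

end
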